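import Summits.CriticalPhenomena.PercolationContinuityZ3.Theorems.PercAnnulusCrossingIICLocalLimit
import Summits.CriticalPhenomena.PercolationContinuityZ3.Theorems.PercAnnulusCrossingIICPlanarTwoPoint
import HarnessLib

/-!
# Away from its root Kesten's IIC on `ℤ²` is critical percolation, unconditionally (lane RSW3, p1 gen 7)

builds on p205010 (kernel theorem, internal audit signed; external expert review pending) — NOT used by the statements of this file,
which are unconditional theorems about bond percolation on `ℤ²` at `p_c(ℤ²) = 1/2` (Harris–Kesten, RSW); p205010 is only in the
import closure.

Seat `prim-rsw3-p1` (gen 7).  Planar companion of `PercAnnulusCrossingIICLocalLimit.lean`: with (A2)□(9,77) on `ℤ²` from RSW (p1 gen 6),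
one-arm doubling (`oneArmDoublingAt_two_criticalProbI`) and `θ(1/2) = 0`:

* **`iicMeasure_abs_real_sub_le_Z2`** — there is `C > 0` such that for EVERY measure `ν` with Kesten's IIC limit property at `p_c(ℤ²)`,
  every finite edge set `F` with endpoints in `W` and every event `E` determined by `F`:
  **`|ν(E) − P_{1/2}(E)| ≤ C · Σ_{w ∈ W} π_{1/2}(‖w‖_∞)`**;
* **`iicMeasure_abs_real_sub_small_Z2`** — hence for every `ε > 0` and `M` there is `n₀` with `|ν(E) − P_{1/2}(E)| ≤ ε` for every event
  determined by a finite edge set whose (at most `M`) endpoints lie outside `Λ(n₀)`: through any bounded window far from the root the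
  planar IIC is indistinguishable from critical percolation, with total-variation error `O(M · π_{1/2}(distance))`.

Helper file for the crux `stmt-CriticalPhenomena-4575` chain; no definitions, no sorries.
References: H. Kesten, PTRF 73 (1986) 369–394, Thm. (3), (1.12)–(1.13); G. Grimmett, *Percolation* (1999), §2.2, §11.7.
-/

noncomputable section

namespace Summit.CriticalPhenomena.PercolationContinuityZ3.Theorems.Crossing

open MeasureTheory ProbabilityTheory Filter Topology
open Literature.Probability.Percolation Literature.Probability.LatticeModels
open Literature.Probability.Percolation.DCT16
open scoped ENNReal ProbabilityTheory Literature.Probability.Percolation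

/-! ## On `ℤ²`, unconditionally -/

/-- **AWAY FROM ITS ROOT KESTEN'S IIC ON `ℤ²` IS CRITICAL PERCOLATION, unconditionally**: there is `C > 0` such that for every measure
`ν` with Kesten's IIC limit property at `p_c(ℤ²) = 1/2`, every finite edge set `F` with endpoints in the finite set `W`, and every event
`E` determined by `F`: **`|ν(E) − P_{1/2}(E)| ≤ C · Σ_{w ∈ W} π_{1/2}(‖w‖_∞)`**.  ((A2)□(9,77) on `ℤ²` from RSW, p1 gen 6; doubling
turns `π(⌊(r−1)/2⌋)` into `π(r)`; sites of norm `≤ 6` are absorbed into the constant.) [cite: Kesten1986, Thm. (3), (1.12)–(1.13)] -/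
theorem iicMeasure_abs_real_sub_le_Z2 :
    ∃ C : ℝ, 0 < C ∧ ∀ (ν : Measure (BondConfig (Site 2))),
      (∀ (F : Finset (Sym2 (Site 2))) (E : Set (BondConfig (Site 2))), MeasurableSet E → DeterminedBy E ↑F →
        Tendsto (fun n : ℕ => (bondPercolation (zdGraph 2) (criticalProbI 2)).real (E ∩ siteToBoundary 2 n) /
          oneArmProb 2 (criticalProbI 2) n) atTop (𝓝 (ν.real E))) →
      ∀ (F : Finset (Sym2 (Site 2))) (W : Finset (Site 2)) (E : Set (BondConfig (Site 2))),
        (∀ e ∈ F, ∀ w ∈ e, w ∈ W) → DeterminedBy E ↑F →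
        |ν.real E - (bondPercolation (zdGraph 2) (criticalProbI 2)).real E| ≤
          C * ∑ w ∈ W, oneArmProb 2 (criticalProbI 2) (Site.supNorm w) := by
  classical
  obtain ⟨ϰ, hϰ, hA2⟩ := exists_setToSetQuasiMultAspectAt_two_of_criticalProbI_le
  obtain ⟨C₁, hC₁, hfin⟩ := real_openConnIn_inter_arm_le_criticalProbI (d := 2) le_rfl (s := 9) (L := 77) (by norm_num)
    (by norm_num) hϰ (hA2 _ le_rfl)
  obtain ⟨cD, hcD, hD⟩ := oneArmDoublingAt_two_criticalProbI
  have hπpos : ∀ n, 0 < oneArmProb 2 (criticalProbI 2) n := oneArmProb_pos (d := 2) (by norm_num) _ criticalProbI_two_pos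
  set μ := bondPercolation (zdGraph 2) (criticalProbI 2) with hμ
  set C := max (C₁ / cD ^ 2) (1 / oneArmProb 2 (criticalProbI 2) 6) with hCdef
  have hCpos : 0 < C := lt_max_of_lt_right (one_div_pos.2 (hπpos 6))
  -- per-site finite-volume bound with the clean rate `π(‖w‖)`
  have hsite : ∀ (w : Site 2) (N : ℕ), 2 * Site.supNorm w ≤ N →
      μ.real (openConnIn (↑(box 2 N) : Set (Site 2)) 0 w ∩ siteToBoundary 2 N) ≤
        C * oneArmProb 2 (criticalProbI 2) (Site.supNorm w) * oneArmProb 2 (criticalProbI 2) N := by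
    intro w N hN
    set r := Site.supNorm w with hr
    by_cases h7 : 7 ≤ r
    · have h := hfin r w h7 (self_mem_sphere w) (↑(box 2 N)) N hN
      set k := (r - 1) / 2 with hk
      have hk1 : 1 ≤ k := by omega
      have hd1 := hD k hk1
      have hd2 := hD (2 * k) (by omega)
      have hchain : cD ^ 2 * oneArmProb 2 (criticalProbI 2) k ≤ oneArmProb 2 (criticalProbI 2) r := by
        calc cD ^ 2 * oneArmProb 2 (criticalProbI 2) k = cD * (cD * oneArmProb 2 (criticalProbI 2) k) := by ring
          _ ≤ cD * oneArmProb 2 (criticalProbI 2) (2 * k) := mul_le_mul_of_nonneg_left hd1 hcD.le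
          _ ≤ oneArmProb 2 (criticalProbI 2) (2 * (2 * k)) := hd2
          _ ≤ oneArmProb 2 (criticalProbI 2) r := real_siteToBoundary_antitone (criticalProbI 2) (by omega)
      calc μ.real (openConnIn (↑(box 2 N) : Set (Site 2)) 0 w ∩ siteToBoundary 2 N)
          ≤ C₁ * oneArmProb 2 (criticalProbI 2) k * oneArmProb 2 (criticalProbI 2) N := h
        _ = C₁ / cD ^ 2 * (cD ^ 2 * oneArmProb 2 (criticalProbI 2) k) * oneArmProb 2 (criticalProbI 2) N := by
            rw [← mul_assoc, div_mul_cancel₀ C₁ (pow_ne_zero 2 hcD.ne')]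
        _ ≤ C₁ / cD ^ 2 * oneArmProb 2 (criticalProbI 2) r * oneArmProb 2 (criticalProbI 2) N :=
            mul_le_mul_of_nonneg_right (mul_le_mul_of_nonneg_left hchain (by positivity)) (hπpos N).le
        _ ≤ C * oneArmProb 2 (criticalProbI 2) r * oneArmProb 2 (criticalProbI 2) N :=
            mul_le_mul_of_nonneg_right (mul_le_mul_of_nonneg_right (le_max_left _ _) (hπpos r).le) (hπpos N).le
    · -- small `r`: `P(· ∩ A_N) ≤ π(N) ≤ (π(r)/π(6)) · π(N)`
      have hr6 : r ≤ 6 := by omega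
      have hπr : oneArmProb 2 (criticalProbI 2) 6 ≤ oneArmProb 2 (criticalProbI 2) r :=
        real_siteToBoundary_antitone (criticalProbI 2) hr6
      have hone : 1 ≤ C * oneArmProb 2 (criticalProbI 2) r := by
        calc (1 : ℝ) = 1 / oneArmProb 2 (criticalProbI 2) 6 * oneArmProb 2 (criticalProbI 2) 6 := by
              rw [one_div_mul_cancel (hπpos 6).ne']
          _ ≤ 1 / oneArmProb 2 (criticalProbI 2) 6 * oneArmProb 2 (criticalProbI 2) r :=
              mul_le_mul_of_nonneg_left hπr (one_div_pos.2 (hπpos 6)).le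
          _ ≤ C * oneArmProb 2 (criticalProbI 2) r := mul_le_mul_of_nonneg_right (le_max_right _ _) (hπpos r).le
      calc μ.real (openConnIn (↑(box 2 N) : Set (Site 2)) 0 w ∩ siteToBoundary 2 N)
          ≤ μ.real (siteToBoundary 2 N) := measureReal_mono Set.inter_subset_right (measure_ne_top _ _)
        _ = 1 * oneArmProb 2 (criticalProbI 2) N := (one_mul _).symm
        _ ≤ C * oneArmProb 2 (criticalProbI 2) r * oneArmProb 2 (criticalProbI 2) N :=
            mul_le_mul_of_nonneg_right hone (hπpos N).le
  refine ⟨C, hCpos, fun ν hν F W E hFW hE => ?_⟩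
  refine iicMeasure_abs_real_sub_le (d := 2) (by norm_num) (criticalProbI 2) criticalProbI_two_pos hν hFW hE ?_
  refine eventually_atTop.2 ⟨W.sup fun w => 2 * Site.supNorm w, fun N hN => ?_⟩
  calc ∑ w ∈ W, μ.real (openConnIn (↑(box 2 N) : Set (Site 2)) 0 w ∩ siteToBoundary 2 N)
      ≤ ∑ w ∈ W, C * oneArmProb 2 (criticalProbI 2) (Site.supNorm w) * oneArmProb 2 (criticalProbI 2) N := by
        refine Finset.sum_le_sum fun w hw => ?_
        exact hsite w N (le_trans (Finset.le_sup (f := fun w => 2 * Site.supNorm w) hw) hN)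
    _ = C * (∑ w ∈ W, oneArmProb 2 (criticalProbI 2) (Site.supNorm w)) * oneArmProb 2 (criticalProbI 2) N := by
        rw [Finset.mul_sum, Finset.sum_mul]

/-- **THE PLANAR IIC THROUGH A FAR WINDOW IS CRITICAL PERCOLATION, unconditionally**: for every measure `ν` with Kesten's IIC limit
property at `p_c(ℤ²)`, every `ε > 0` and every `M` there is `n₀` such that `|ν(E) − P_{1/2}(E)| ≤ ε` for every event `E` determined by a
finite edge set whose (at most `M`) endpoints lie outside `Λ(n₀)` (`π_{1/2}(m) → θ(1/2) = 0`, Harris–Kesten).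
[cite: Kesten1986, Thm. (3), (1.12)–(1.13)] -/
theorem iicMeasure_abs_real_sub_small_Z2 {ν : Measure (BondConfig (Site 2))}
    (hν : ∀ (F : Finset (Sym2 (Site 2))) (E : Set (BondConfig (Site 2))), MeasurableSet E → DeterminedBy E ↑F →
      Tendsto (fun n : ℕ => (bondPercolation (zdGraph 2) (criticalProbI 2)).real (E ∩ siteToBoundary 2 n) /
        oneArmProb 2 (criticalProbI 2) n) atTop (𝓝 (ν.real E)))
    {ε : ℝ} (hε : 0 < ε) (M : ℕ) :
    ∃ n₀ : ℕ, ∀ (F : Finset (Sym2 (Site 2))) (W : Finset (Site 2)) (E : Set (BondConfig (Site 2))),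
      (∀ e ∈ F, ∀ w ∈ e, w ∈ W) → W.card ≤ M → (∀ w ∈ W, w ∉ box 2 n₀) → DeterminedBy E ↑F →
      |ν.real E - (bondPercolation (zdGraph 2) (criticalProbI 2)).real E| ≤ ε := by
  obtain ⟨C, hC, hb⟩ := iicMeasure_abs_real_sub_le_Z2
  -- `π_{p_c(ℤ²)}(m) → θ = 0` (Harris + Kesten)
  have hθ : theta (zdGraph 2) 0 (criticalProbI 2) = 0 :=
    percolationContinuity_two kesten_criticalProb_Z2_holds harris_theta_half_holds
  have hlim : Tendsto (fun m : ℕ => oneArmProb 2 (criticalProbI 2) m) atTop (𝓝 0) := by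
    have h := Literature.Probability.Percolation.tendsto_real_siteToBoundary (d := 2) (criticalProbI 2)
    rw [hθ] at h
    exact h
  have hεC : 0 < ε / (C * (M + 1)) := by positivity
  obtain ⟨m₀, hm₀⟩ := eventually_atTop.1 ((tendsto_order.1 hlim).2 (ε / (C * (M + 1))) hεC)
  refine ⟨m₀, fun F W E hFW hcard hfar hE => ?_⟩
  refine (hb ν hν F W E hFW hE).trans ?_
  have hterm : ∀ w ∈ W, oneArmProb 2 (criticalProbI 2) (Site.supNorm w) ≤ ε / (C * (M + 1)) := fun w hw => by
    have hn : m₀ < Site.supNorm w := by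
      by_contra h'
      push Not at h'
      exact hfar w hw (mem_box_iff_supNorm_le.2 h')
    exact (hm₀ _ hn.le).le
  have hM : (W.card : ℝ) ≤ M := by exact_mod_cast hcard
  calc C * ∑ w ∈ W, oneArmProb 2 (criticalProbI 2) (Site.supNorm w)
      ≤ C * ∑ _w ∈ W, ε / (C * (M + 1)) := mul_le_mul_of_nonneg_left (Finset.sum_le_sum hterm) hC.le
    _ = C * (W.card * (ε / (C * (M + 1)))) := by rw [Finset.sum_const, nsmul_eq_mul]
    _ ≤ C * ((M : ℝ) * (ε / (C * (M + 1)))) :=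
        mul_le_mul_of_nonneg_left (mul_le_mul_of_nonneg_right hM hεC.le) hC.le
    _ = ε * ((M : ℝ) / (M + 1)) := by field_simp
    _ ≤ ε * 1 := by
        refine mul_le_mul_of_nonneg_left ?_ hε.le
        rw [div_le_one (by positivity)]
        linarith
    _ = ε := mul_one ε

end Summit.CriticalPhenomena.PercolationContinuityZ3.Theorems.Crossing

end
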